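import Literature.Barriers.QuantumAdvantage.PromiseLiftRelativization
import Literature.Barriers.QuantumAdvantage.CohenGenericJoinPneNP
import Literature.Computability.Complexity.CoinCounting
import Literature.Computability.MetaComplexity.GapMINKTSearchProofs
import HarnessLib

/-!
# The floor `H₀` does not relativize: Fortnow's Hypothesis III fails in the brain world `K ⊕ G`

Solo programme `solo-QuantumAdvantage-informed` (door theory of `QuantumAdvantage : ∃ L ∈ BQP, L ∉ BPP`).
The DOOR is `Q-EXT : PromiseBQP ⊆ promiseLift BQP`; its classical FLOOR is
`H₀ : PromiseBPP' ⊆ promiseLift BQP`, with sibling `C-EXT′ : PromiseBPP' ⊆ promiseLift BPP`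
(`Theorems/SoloInformedDoorFloor.lean`); `PromiseBPP' ⊆ promiseLift P` is Fortnow's **Hypothesis III**
"Promise-BPP is easy" [Fortnow 2001, Def. 2.5 (p. 3 l. 54 – p. 4 l. 3), Thm. 2.7].

PROVED (axioms `propext`, `Classical.choice`, `Quot.sound`): (a–b) the TALLY promise problem `genMaj G`
("density of `G` at length `n` ≥ 2/3 or ≤ 1/3?", inputs `0ⁿ`) is in `PromiseBPP'^{B ⊕ G}` for every
base `B`; (c–d) for every deterministic pair `(M, q)` the Cohen conditions forcing "`M^G` with budget
`q(n)` errs on the promise of `genMaj G` at some level" are DENSE (`isDense_forces_majFail`: fresh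
length, run from the background oracle, freeze the `≤ q(n) < 2ⁿ/3` answers, fill all unqueried strings
of that length or none; `run_congr`); (e–f) hence for every `B` and every `G` generic for the countable
family `majFamily B` of requirements of the absorbed machines `M.absorb (joinView B)`,
`PromiseBPP'^{B ⊕ G} ⊄ promiseLift (P^{B ⊕ G})` with a tally witness
(`promiseBPP'Rel_not_subset_promiseLift_PRel_join_of_isGeneric`); (g) the tree's
`exists_generic_world_of_collapse` with ONE MORE countable family met by the generic
(`exists_generic_world_of_collapse_of_family`) gives ONE oracle `A = K ⊕ G` (`K = Cor37Brain.oracleK`)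
with `P^A = BPP^A = BQP^A = AWPP^A`, `PH^A` infinite, `PromiseBQP^A ⊄ PromiseBPP'^A`, `¬ Q-EXT^A`, and a
tally `Q ∈ PromiseBPP'^A` outside `promiseLift P^A = promiseLift BPP^A = promiseLift BQP^A` — i.e.
`H₀`, `C-EXT′` and Hypothesis III all FAIL at `A` while Hypothesis IV (`P = BPP`) holds
(`exists_oracle_doorTable`); (h) `not_relativizes_floor` / `…_hypothesisIII` / `…_classicalPromisesLift`.
Since `H₀` follows from `prBPP = prP` (believed), the floor is believed-true but non-relativizing.

ATTRIBUTION. Parts (c)–(f) REPRODUCE, in the tree's forcing toolkit (`GenericOracles`,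
`CohenGenericPneNP`, `OracleAbsorb`), Fortnow's remark [Fortnow 2001, §2 p. 5 ll. 10–12: "consider a
generic oracle built on top of TQBF: Impagliazzo and Naor [IN88] show that `P = BPP` relative to this
oracle but one easily gets that Hypothesis III fails"], moved from the base TQBF to an ARBITRARY base
and then to the brain base `K`, where `P = BPP = BQP = AWPP` is the tree's Fenner–Fortnow–Kurtz–Li /
Fortnow–Rogers collapse (`FFKL.PRel_eq_AWPPRel_of_isGeneric_of_stdAlg`, `BQPRel_subset_AWPPRel_holds`).
The stage is Baker–Gill–Solovay's [Arora–Barak 2009, Thm. 3.7]; requirements by finite extension and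
absorbed machines are [FFKL 2003, §1 p. 3, §3.2 p. 14]. New is only the placement: the floor of the solo
door theory fails, by a tally witness, in the very world that kills the promise lift.

References: [Fortnow2001Derandomization] Def. 2.5, Thm. 2.7, §2 p. 5 (`lit read doi:10.1109/ccc.2001.933869`
pp. 3–5); [ImpagliazzoNaor1988]; [FennerFortnowKurtzLi2003IC] §1 p. 3, §3.2 p. 14, Lemma 3.12;
[FortnowRogers1999JCSS] Cor. 3.7; [AroraBarakCC2009] Thm. 3.7, §7.1; [Goldreich2006] Def. 1.2, §1.2. -/

noncomputable section

namespace Summit.QuantumAdvantage.QuantumAdvantage.Theorems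

open _root_.Computability Literature.Computability.Complexity Literature.Computability.Complexity.Classes
  Literature.Computability.Complexity.CohenCondition Literature.Computability.Cryptography
  Literature.Computability.QuantumComplexity Literature.Barriers.QuantumAdvantage
  Literature.Barriers.PneNP Polynomial

open scoped Literature.Computability.Complexity.Notation

/-- **The generic majority problem of `G`** (tally): yes-instances are the `0ⁿ` with at least `2/3`
of the strings of length `n` in `G`, no-instances the `0ⁿ` with at least `2/3` of them outside `G`.
[cite: Fortnow2001Derandomization, Def. 2.5 and §2 p. 5] -/
def genMaj (G : Language Bool) : PromiseProblem :=
  ⟨{x | x = List.replicate x.length false ∧ 2 / 3 ≤ uniformProb x.length G},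
   {x | x = List.replicate x.length false ∧ 2 / 3 ≤ uniformProb x.length Gᶜ}⟩

/-- The generic majority problem is tally (`⊆ 0*`). [folklore] -/
theorem isTally_genMaj (G : Language Bool) : IsTally (genMaj G).yes ∧ IsTally (genMaj G).no :=
  ⟨fun _ hw _ hb => List.eq_of_mem_replicate (hw.1 ▸ hb),
    fun _ hw _ hb => List.eq_of_mem_replicate (hw.1 ▸ hb)⟩

/-- **`genMaj G ∈ PromiseBPP'^{B ⊕ G}`** for every base `B`: the `P^{B ⊕ G}` language `{⟨x, y⟩ | y ∈ G}`
with the coin polynomial `X` (one query on a uniform string of length `|x|`). [cite: Fortnow2001Derandomization, §2 p. 5] [cite: Goldreich2006, Def. 1.2] -/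
theorem genMaj_mem_PromiseBPP'Rel_join (B G : Language Bool) :
    genMaj G ∈ PromiseBPP'Rel (Oracle.ofLanguage (oracleJoin B G)) := by
  refine ⟨{z | sndP z ∈ G}, mem_PRel_of_karpReducible ⟨sndP, sndP_mem_FP, fun _ => Iff.rfl⟩
    (self_mem_PRel_join B G), X, fun x hx => ?_, fun x hx => ?_⟩
  · rw [eval_X, uniformProb_eq_cnt_div,
      cnt_congr (E' := G) fun y _ => by
        show sndP (boolPair x y) ∈ G ↔ y ∈ G
        rw [sndP_boolPair],
      ← uniformProb_eq_cnt_div]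
    exact hx.2
  · rw [eval_X, uniformProb_eq_cnt_div,
      cnt_congr (E' := Gᶜ) fun y _ => by
        show ¬ (sndP (boolPair x y) ∈ G) ↔ ¬ (y ∈ G)
        rw [sndP_boolPair],
      ← uniformProb_eq_cnt_div]
    exact hx.2

/-- **The requirement `R_{M,q}`**, as the set of oracles `G` meeting it: at some level `n`, `0ⁿ`
satisfies the promise of `genMaj G` but the run of `M` with oracle `G` and budget `q(n)` does not
output the right answer (yes-side: output `≠ 1`; no-side: output `≠ 0`).
[cite: FortnowRogers1999JCSS, §2.6 (arXiv numbering)] [cite: Fortnow2001Derandomization, §2 p. 5] -/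
def majFail (M : OracleAlg Bool) (q : Polynomial ℕ) : Set (Language Bool) :=
  {G | ∃ n : ℕ,
    (2 / 3 ≤ uniformProb n G ∧
        M.run (Oracle.ofLanguage G) (q.eval n) (List.replicate n false) ≠ some true) ∨
      (2 / 3 ≤ uniformProb n Gᶜ ∧
        M.run (Oracle.ofLanguage G) (q.eval n) (List.replicate n false) ≠ some false)}

/-- At most `|Q|` strings of length `m` lie in the list `Q`. [folklore] -/
theorem cnt_setOf_mem_list_le (m : ℕ) (Q : List (List Bool)) :
    cnt m {w | w ∈ Q} ≤ Q.length := by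
  classical
  unfold cnt
  refine le_trans ?_ (List.toFinset_card_le Q)
  refine Finset.card_le_card_of_injOn (fun r : List.Vector Bool m => r.toList) (fun r hr => ?_)
    fun r _ r' _ h => List.Vector.toList_injective h
  simp only [Finset.coe_filter, Finset.mem_univ, true_and, Set.mem_setOf_eq] at hr
  simpa using hr

/-- **Density of the forcing sets** (the stage): some extension of any `τ` forces `R_{M,q}` — fresh
length `n` above `dom τ` with `3 q(n) < 2ⁿ`; run `M` on `0ⁿ` from the background oracle of `τ`; freeze
`dom τ`, the `≤ q(n)` queried strings and all strings of length `n`: as they are if the run accepted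
(no string of length `n` in the oracle: a no-instance answered yes), with every UNQUERIED string of
length `n` put in otherwise (density `> 2/3`: a yes-instance not answered yes); the run is unchanged
(`run_congr`). [cite: AroraBarakCC2009, Thm. 3.7 (proof, pp. 74–75)] [cite: FennerFortnowKurtzLi2003IC, §1 p. 3] [cite: Fortnow2001Derandomization, §2 p. 5] -/
theorem isDense_forces_majFail (M : OracleAlg Bool) (q : Polynomial ℕ) :
    IsDense {σ : CohenCondition | σ.Forces (· ∈ majFail M q)} := by
  classical
  intro τ
  set A₀ : Set (List Bool) := {w | τ.val w = some true} with hA₀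
  have hτA₀ : τ.ExtendedBy A₀ := BGS.extendedBy_setOf_val_eq_true τ
  obtain ⟨N, hN⟩ := BGS.exists_length_le_of_mem_dom τ
  obtain ⟨n, hNn, hqn⟩ := BGS.exists_lt_two_pow (3 * q) N
  have hqn' : 3 * q.eval n < 2 ^ n := by simpa [eval_mul] using hqn
  have hfresh : ∀ y : List Bool, y.length = n → y ∉ τ.dom := fun y hy hyd => by
    have := hN y hyd
    omega
  have hfreshA₀ : ∀ y : List Bool, y.length = n → y ∉ A₀ := fun y hy hyA =>
    hfresh y hy (by rw [mem_dom_iff, show τ.val y = some true from hyA]; exact Option.some_ne_none _)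
  set k := q.eval n with hk
  set x₀ : List Bool := List.replicate n false with hx₀
  set Q := M.queries (Oracle.ofLanguage A₀) k x₀ with hQ
  have hQlen : Q.length ≤ k := M.length_queries_le _ _ _
  have hLfin : {y : List Bool | y.length = n}.Finite := List.finite_length_eq Bool n
  set s : Finset (List Bool) := τ.dom_finite.toFinset ∪ Q.toFinset ∪ hLfin.toFinset with hs
  have hdom_s : τ.dom ⊆ ↑s := fun w hw => by simp [hs, hw]
  have hQ_s : ∀ w ∈ Q, w ∈ s := fun w hw => by simp [hs, hw]
  have hlen_s : ∀ y : List Bool, y.length = n → y ∈ s := fun y hy => by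
    have : y ∈ {y : List Bool | y.length = n} := hy
    simp [hs, this]
  by_cases hres : M.run (Oracle.ofLanguage A₀) k x₀ = some true
  · refine ⟨restrict A₀ s, ?_, le_restrict_of_extendedBy hτA₀ hdom_s⟩
    intro G hG
    refine ⟨n, Or.inr ⟨?_, ?_⟩⟩
    · have hc : cnt n Gᶜ = 2 ^ n := cnt_eq_two_pow_of_forall fun y hy hyG =>
        hfreshA₀ y hy ((BGS.mem_iff_mem_of_extendedBy_restrict hG (hlen_s y hy)).1 hyG)
      rw [uniformProb_eq_cnt_div, hc]
      push_cast
      rw [div_self (by positivity)]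
      norm_num
    · have hrun : M.run (Oracle.ofLanguage G) k x₀ = M.run (Oracle.ofLanguage A₀) k x₀ :=
        Literature.Computability.QuantumComplexity.run_congr M fun w hw =>
          Oracle.ofLanguage_apply_eq_of_iff (BGS.mem_iff_mem_of_extendedBy_restrict hG (hQ_s w hw))
      rw [hrun, hres]
      simp
  · set A₁ : Set (List Bool) := A₀ ∪ {y | y.length = n ∧ y ∉ Q} with hA₁
    have hτA₁ : τ.ExtendedBy A₁ := by
      intro w b hw
      have hwn : ¬ (w.length = n ∧ w ∉ Q) := fun h =>
        hfresh w h.1 (by rw [mem_dom_iff, hw]; exact Option.some_ne_none b)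
      refine Iff.trans (b := w ∈ A₁) Iff.rfl ?_
      rw [hA₁, Set.mem_union, Set.mem_setOf_eq, Set.mem_setOf_eq, or_iff_left hwn]
      exact hτA₀ w b hw
    refine ⟨restrict A₁ s, ?_, le_restrict_of_extendedBy hτA₁ hdom_s⟩
    intro G hG
    refine ⟨n, Or.inl ⟨?_, ?_⟩⟩
    · have hcnt : cnt n Gᶜ ≤ k := by
        refine le_trans (Literature.Computability.MetaComplexity.GapMINKTDecision.cnt_mono
          fun y hy hyG => ?_) ((cnt_setOf_mem_list_le n Q).trans hQlen)
        by_contra hyQ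
        have hyA₁ : y ∈ A₁ := (Set.mem_union _ _ _).2 (Or.inr ⟨hy, hyQ⟩)
        exact hyG ((BGS.mem_iff_mem_of_extendedBy_restrict hG (hlen_s y hy)).2 hyA₁)
      have h3 : 3 * cnt n Gᶜ < 2 ^ n := lt_of_le_of_lt (Nat.mul_le_mul_left 3 hcnt) hqn'
      have hnat : 2 * 2 ^ n ≤ 3 * cnt n G := by
        have hsum := cnt_add_cnt_compl n G
        generalize 2 ^ n = T at hsum h3 ⊢
        omega
      rw [uniformProb_eq_cnt_div, le_div_iff₀ (by positivity)]
      have hreal : ((2 * 2 ^ n : ℕ) : ℝ) ≤ ((3 * cnt n G : ℕ) : ℝ) := by exact_mod_cast hnat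
      push_cast at hreal
      linarith
    · have hrun : M.run (Oracle.ofLanguage G) k x₀ = M.run (Oracle.ofLanguage A₀) k x₀ :=
        Literature.Computability.QuantumComplexity.run_congr M fun w hw => Oracle.ofLanguage_apply_eq_of_iff (by
          rw [BGS.mem_iff_mem_of_extendedBy_restrict hG (hQ_s w hw), hA₁, Set.mem_union,
            Set.mem_setOf_eq]
          exact ⟨fun h => h.elim id fun h' => absurd hw h'.2, Or.inl⟩)
      rw [hrun]
      exact hres

/-- The family of forcing sets of the requirements of the absorbed machines
`M.absorb (joinView B) (q ∘ length)` over all polynomial-time pairs `(M, q)` (the base `B` is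
internalised into the machine, Fenner–Fortnow–Kurtz–Li rerelativization).
[cite: FennerFortnowKurtzLi2003IC, §1 p. 3 and §3.2 p. 14] -/
def majFamily (B : Language Bool) : Set (Set CohenCondition) :=
  (fun D : OracleAlg Bool × Polynomial ℕ =>
      {σ : CohenCondition |
        σ.Forces (· ∈ majFail (D.1.absorb (joinView B) fun x => D.2.eval x.length) D.2)}) ''
    {D | D.1.IsPolyTime encodingBoolBool}

/-- The family is countable (machines as strings). [cite: AroraBarakCC2009, §1.4] -/
theorem majFamily_countable (B : Language Bool) : (majFamily B).Countable := by
  obtain ⟨e, he⟩ := BGS.exists_enum_pair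
  exact ((Set.countable_range e).mono he).image _

/-- Every member of the family is dense. [cite: AroraBarakCC2009, Thm. 3.7 (proof)] -/
theorem isDense_of_mem_majFamily {B : Language Bool} {S : Set CohenCondition}
    (hS : S ∈ majFamily B) : IsDense S := by
  obtain ⟨D, -, rfl⟩ := hS
  exact isDense_forces_majFail _ _

/-- **`PromiseBPP'^{B ⊕ G} ⊄ promiseLift (P^{B ⊕ G})` for a `majFamily B`-generic `G`**, witnessed
by the tally problem `genMaj G`: a `P^{B ⊕ G}` pair `(M, q)` whose language separates `genMaj G`
would, absorbed (`OracleAlg.run_absorb`, `absorbedOracle_joinView`), answer the promise correctly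
with oracle `G` at every level, against the forced requirement. This is Fortnow's "one easily gets
that Hypothesis III fails" for a generic on top of any base. [cite: Fortnow2001Derandomization, §2 p. 5 (ll. 10–12) and Def. 2.5] [cite: FennerFortnowKurtzLi2003IC, §3.2 p. 14] -/
theorem promiseBPP'Rel_not_subset_promiseLift_PRel_join_of_isGeneric {B G : Language Bool}
    (hG : IsGeneric (majFamily B) G) :
    ∃ Q ∈ PromiseBPP'Rel (Oracle.ofLanguage (oracleJoin B G)), (IsTally Q.yes ∧ IsTally Q.no) ∧
      Q ∉ promiseLift (PRel (Oracle.ofLanguage (oracleJoin B G))) := by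
  refine ⟨genMaj G, genMaj_mem_PromiseBPP'Rel_join B G, isTally_genMaj G, ?_⟩
  rintro ⟨L, ⟨M, hM, q, hq⟩, hyes, hno⟩
  have hR : G ∈ majFail (M.absorb (joinView B) fun x => q.eval x.length) q :=
    hG.of_forces_of_mem ⟨(M, q), hM, rfl⟩ (isDense_forces_majFail _ _) fun _ h => h
  rw [majFail, Set.mem_setOf_eq] at hR
  obtain ⟨n, hn⟩ := hR
  have h1 := (hq (List.replicate n false)).1
  rw [← absorbedOracle_joinView] at h1
  have habs := OracleAlg.run_absorb (F := fun x => q.eval x.length) M (joinView B) (Oracle.ofLanguage G)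
    (List.replicate n false) le_rfl h1
  rw [List.length_replicate] at habs
  rcases hn with ⟨hpr, hrun⟩ | ⟨hpr, hrun⟩
  · have hmem : List.replicate n false ∈ (genMaj G).yes :=
      ⟨by rw [List.length_replicate], by rw [List.length_replicate]; exact hpr⟩
    have hL : List.replicate n false ∈ L := hyes hmem
    exact hrun (by rw [habs, (Set.mem_iff_boolIndicator _ _).1 hL])
  · have hmem : List.replicate n false ∈ (genMaj G).no :=
      ⟨by rw [List.length_replicate], by rw [List.length_replicate]; exact hpr⟩
    have hL : List.replicate n false ∉ L := fun h => hno hmem h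
    exact hrun (by rw [habs, (Set.notMem_iff_boolIndicator _ _).1 hL])

/-- **The generic world over an arbitrary base, meeting one more family** — the tree's
`exists_generic_world_of_collapse` with an extra countable family `𝒯` of sets of conditions for
which the generic is also generic: relative to `A = K ⊕ G`, `P^A = AWPP^A`, `PH^A` is infinite,
`PromiseBQP^A ⊄ PromiseBPP'^A`, and `G` is `𝒯`-generic. (Proof = the tree's, with `𝒯` added to
the union of families handed to `exists_isGeneric`.) [cite: FortnowRogers1999JCSS, Cor. 3.7 and its proof] [cite: RazTalJACM2022, App. A] [cite: FennerFortnowKurtzLi2003IC, Lemma 3.12] -/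
theorem exists_generic_world_of_collapse_of_family (K : Language Bool)
    {𝒮c 𝒯 : Set (Set CohenCondition)} (h𝒮c : 𝒮c.Countable) (h𝒯 : 𝒯.Countable)
    (hcoll : ∀ G : Language Bool, IsGeneric 𝒮c G →
      PRel (Oracle.ofLanguage (oracleJoin K G)) = AWPPRel (Oracle.ofLanguage (oracleJoin K G))) :
    ∃ G : Language Bool, IsGeneric 𝒯 G ∧
      PRel (Oracle.ofLanguage (oracleJoin K G)) = AWPPRel (Oracle.ofLanguage (oracleJoin K G)) ∧
      IsInfinitePHRel (Oracle.ofLanguage (oracleJoin K G)) ∧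
      ¬ (PromiseBQPRel (oracleJoin K G) ⊆ PromiseBPP'Rel (Oracle.ofLanguage (oracleJoin K G))) := by
  classical
  obtain ⟨e, he⟩ := exists_enum_PHDescr countable_polyTimeOracleAlg_holds
  choose thr hthr using fun D : PHDescr => exists_forces_promiseLiftFailsAt K D.M D.q (D.bounds.headD 0)
  set Rq : ℕ → Language Bool → Prop := fun i G =>
    ∃ n, thr (e i) ≤ n ∧ PromiseLiftFailsAt K (e i).M (e i).q ((e i).bounds.headD 0) n G with hRqdef
  have hdense : ∀ i, CohenCondition.IsDense {σ : CohenCondition | σ.Forces (Rq i)} := by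
    intro i
    rw [CohenCondition.isDense_iff]
    intro τ
    obtain ⟨L, hL⟩ := BGS.exists_length_le_of_mem_dom τ
    set n := max (thr (e i)) (L + 1) with hn
    obtain ⟨σ, hτσ, hσ⟩ := hthr (e i) n (le_max_left _ _) τ fun s hs => by
      have h1 := hL s hs
      have h2 : L + 1 ≤ n := le_max_right _ _
      have h3 := le_rtLen n
      omega
    exact ⟨σ, fun G hG => ⟨n, le_max_left _ _, hσ G hG⟩, hτσ⟩
  obtain ⟨𝒮, h𝒮, hPH⟩ := isInfinitePHRel_join_generic_holds K
  obtain ⟨G, hG⟩ := exists_isGeneric ((((h𝒮c.union h𝒮).union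
    (Set.countable_range fun i => {σ : CohenCondition | σ.Forces (Rq i)})).union h𝒯))
  have hG' := (isGeneric_union.1 hG).1
  have hG₄ := (isGeneric_union.1 hG).2
  have hG₁ := (isGeneric_union.1 (isGeneric_union.1 hG').1).1
  have hG₂ := (isGeneric_union.1 (isGeneric_union.1 hG').1).2
  have hG₃ := (isGeneric_union.1 hG').2
  have hRq : ∀ i, Rq i G := fun i => hG₃.of_forces (Set.mem_range_self i) (hdense i)
  refine ⟨G, hG₄, hcoll G hG₁, hPH G hG₂, ?_⟩
  intro hsub
  obtain ⟨F, hFu, hF⟩ := razTalPrefixed_bqpMachine 0 fun _ => false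
  have hacc : ∀ x, F.acceptProbOn (oracleJoin K G) x = q1Accept x.length (rtWindow G x.length) := by
    intro x
    rw [(hF (oracleJoin K G) x).2 (Nat.zero_le _), ← rtWindow_preLang]
    have hG'' : preLang (oracleJoin K G) = G := by
      ext t; exact true_cons_mem_oracleJoin
    rw [hG'']
  obtain ⟨L', hL'P, p, hyes, hno⟩ := hsub (machinePromise_mem_PromiseBQPRel hFu (oracleJoin K G))
  obtain ⟨M, hM, q, hq⟩ := hL'P
  have hbase : baseLang M q (oracleJoin K G) = L' := baseLang_eq_of_PRel hq
  obtain ⟨i, hi⟩ := he (show (⟨[p], M, q⟩ : PHDescr) ∈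
    {D : PHDescr | D.M.IsPolyTime encodingBoolBool} from hM)
  obtain ⟨n, -, hbad⟩ := hRq i
  rw [hi] at hbad
  change PromiseLiftFailsAt K M q p n G at hbad
  rcases hbad with ⟨hq1, hpr⟩ | ⟨hq1, hpr⟩
  · have hmem : List.replicate n true ∈ (machinePromise F (oracleJoin K G)).yes := by
      show 2 / 3 ≤ F.acceptProbOn (oracleJoin K G) (List.replicate n true)
      rw [hacc, List.length_replicate]; exact hq1
    have h := hyes _ hmem
    rw [List.length_replicate, ← hbase] at h
    linarith
  · have hmem : List.replicate n true ∈ (machinePromise F (oracleJoin K G)).no := by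
      show F.acceptProbOn (oracleJoin K G) (List.replicate n true) ≤ 1 / 3
      rw [hacc, List.length_replicate]; exact hq1
    have h := hno _ hmem
    rw [List.length_replicate, ← hbase] at h
    have hc : {y : List Bool | boolPair (List.replicate n true) y ∉ baseLang M q (oracleJoin K G)} =
        {y : List Bool | boolPair (List.replicate n true) y ∈ baseLang M q (oracleJoin K G)}ᶜ := rfl
    rw [hc, Literature.Computability.Complexity.uniformProb_compl] at h
    linarith

/-- **The door table at one oracle.** There is an oracle language `A` relative to which
(1) `P^A = BQP^A`, (2) `BPP^A = P^A`, (3) `PH^A` is infinite, (4) `PromiseBQP^A ⊄ PromiseBPP'^A`,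
(5) `¬ Q-EXT^A`: `PromiseBQP^A ⊄ promiseLift (BQP^A)`, and (6) one TALLY promise problem
`Q ∈ PromiseBPP'^A` lies outside `promiseLift (P^A)`, outside `promiseLift (BPP^A)` and outside
`promiseLift (BQP^A)` — i.e. Fortnow's Hypothesis III, the classical lift `C-EXT′` and the floor
`H₀` all fail relative to `A` while Hypothesis IV (`P = BPP`) and `BQP = BPP` hold.
[cite: Fortnow2001Derandomization, §2 p. 5 and Def. 2.5] [cite: FortnowRogers1999JCSS, Cor. 3.7] [cite: AaronsonArkhipov2013, §10 (10)] -/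
theorem exists_oracle_doorTable :
    ∃ A : Language Bool,
      PRel (Oracle.ofLanguage A) = BQPRel A ∧
      BPPRel (Oracle.ofLanguage A) = PRel (Oracle.ofLanguage A) ∧
      IsInfinitePHRel (Oracle.ofLanguage A) ∧
      ¬ (PromiseBQPRel A ⊆ PromiseBPP'Rel (Oracle.ofLanguage A)) ∧
      ¬ (PromiseBQPRel A ⊆ promiseLift (BQPRel A)) ∧
      ∃ Q ∈ PromiseBPP'Rel (Oracle.ofLanguage A), (IsTally Q.yes ∧ IsTally Q.no) ∧
        Q ∉ promiseLift (PRel (Oracle.ofLanguage A)) ∧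
        Q ∉ promiseLift (BPPRel (Oracle.ofLanguage A)) ∧
        Q ∉ promiseLift (BQPRel A) := by
  obtain ⟨G, hGen, hPA, hPH, hsep⟩ := exists_generic_world_of_collapse_of_family Cor37Brain.oracleK
    (FFKL.family_countable _) (majFamily_countable _)
    fun _ hG => FFKL.PRel_eq_AWPPRel_of_isGeneric_of_stdAlg Cor37Brain.stdAlg_oracleK hG
  set A := oracleJoin Cor37Brain.oracleK G with hA
  have hPBQP : PRel (Oracle.ofLanguage A) = BQPRel A := by
    refine Set.Subset.antisymm ?_ ?_
    · exact PRel_ofLanguage_subset_BQPRel_of_BPPRel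
        (BPPRel_ofLanguage_subset_BQPRel_of_sim uniformOracleCoinSimulation_holds) PRel_subset_BPPRel_holds _
    · rw [hPA]
      exact BQPRel_subset_AWPPRel_holds _
  have hBPP : BPPRel (Oracle.ofLanguage A) = PRel (Oracle.ofLanguage A) := by
    refine Set.Subset.antisymm ?_ (PRel_subset_BPPRel_holds _)
    rw [hPBQP]
    exact BPPRel_ofLanguage_subset_BQPRel_of_sim uniformOracleCoinSimulation_holds _
  have hBQPBPP : BQPRel A ⊆ BPPRel (Oracle.ofLanguage A) := by
    rw [hBPP, hPBQP]
  obtain ⟨Q, hQ, hT, hnQ⟩ := promiseBPP'Rel_not_subset_promiseLift_PRel_join_of_isGeneric hGen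
  refine ⟨A, hPBQP, hBPP, hPH, hsep, fun hext => hsep ?_, Q, hQ, hT, hnQ, ?_, ?_⟩
  · exact hext.trans ((promiseLift_mono hBQPBPP).trans (promiseLift_BPPRel_subset_PromiseBPP'Rel _))
  · rw [hBPP]; exact hnQ
  · rw [← hPBQP]; exact hnQ

/-- **The floor `H₀ : O ↦ PromiseBPP'^O ⊆ promiseLift (BQP^O)` does not relativize**, for every
presentation of `BQP^O` agreeing with `BQPRel` on language oracles. [cite: AroraBarakCC2009, §3.4 and Thm. 3.7 (p. 74)] [cite: Fortnow2001Derandomization, §2 p. 5] -/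
theorem not_relativizes_floor {C : Oracle → Set (Language Bool)} (hC : PresentsBQPRel C) :
    ¬ Relativizes fun O => PromiseBPP'Rel O ⊆ promiseLift (C O) := by
  obtain ⟨A, -, -, -, -, -, Q, hQ, -, -, -, hnQ⟩ := exists_oracle_doorTable
  intro hrel
  have h1 : PromiseBPP'Rel (Oracle.ofLanguage A) ⊆ promiseLift (C (Oracle.ofLanguage A)) := hrel A
  rw [hC A] at h1
  exact hnQ (h1 hQ)

/-- **Fortnow's Hypothesis III `O ↦ PromiseBPP'^O ⊆ promiseLift (P^O)` does not relativize** (and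
fails in a world where Hypothesis IV `P = BPP` holds). [cite: Fortnow2001Derandomization, §2 p. 5 ([IN88])] -/
theorem not_relativizes_hypothesisIII : ¬ Relativizes fun O => PromiseBPP'Rel O ⊆ promiseLift (PRel O) := by
  obtain ⟨A, -, -, -, -, -, Q, hQ, -, hnQ, -, -⟩ := exists_oracle_doorTable
  exact fun hrel => hnQ (hrel A hQ)

/-- **The classical lift `C-EXT′ : O ↦ PromiseBPP'^O ⊆ promiseLift (BPP^O)` does not relativize.**
[cite: Goldreich2011, §6] [cite: Fortnow2001Derandomization, §2 p. 5] -/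
theorem not_relativizes_classicalPromisesLift :
    ¬ Relativizes fun O => PromiseBPP'Rel O ⊆ promiseLift (BPPRel O) := by
  obtain ⟨A, -, -, -, -, -, Q, hQ, -, -, hnQ, -⟩ := exists_oracle_doorTable
  exact fun hrel => hnQ (hrel A hQ)

/-- **Anchor**: at the empty oracle the floor family (canonical presentation `bqpRelOf`) is
literally `H₀ : PromiseBPP' ⊆ promiseLift BQP`, and the Hypothesis-III family is
`PromiseBPP' ⊆ PromiseP` (`PromiseBPP'Rel_empty`, `bqpRelOf_empty`, `PRel_empty_holds`).
[cite: Fortnow2001Derandomization, Def. 2.5] [cite: Goldreich2006, Def. 1.2] -/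
theorem floor_shape_empty_iff :
    ((PromiseBPP'Rel Oracle.empty ⊆ promiseLift (bqpRelOf Oracle.empty)) ↔
        (PromiseBPP' ⊆ promiseLift BQP)) ∧
      ((PromiseBPP'Rel Oracle.empty ⊆ promiseLift (PRel Oracle.empty)) ↔ (PromiseBPP' ⊆ PromiseP)) := by
  rw [PromiseBPP'Rel_empty, bqpRelOf_empty BQPRel_zero_holds,
    show PRel Oracle.empty = Classes.P from PRel_empty_holds]
  exact ⟨Iff.rfl, Iff.rfl⟩

end Summit.QuantumAdvantage.QuantumAdvantage.Theorems

end
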